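/-
Copyright (c) 2026 the pub-hodgecm-mathlib formalisation cell (harness21).  Prover seat hodgecm-mathlib-F0P3-p01 (g24); E1 keeper ∕ dealer F0P3a-p03 (g30), E1 BRICK LEDGER
row 59 «K2′∕K4′-UNR ASSEMBLY HEADS» — GLUE C «(J′) SMOOTH PRESENTATION COUNT» of census `CENSUS-R59-K2K4-UNR.v1` (2026-09-03).
-/
import Literature.RepresentationTheory.IntertwiningMapPresentationExtension   -- ★ (J) row 50 p853381: `exists_pushout_extension`, `comp_injective_of_surjective`, `comp_eq_zero_iff_exists_comp_eq`
import Literature.NumberTheory.Automorphic.SmoothRepresentation                -- ★ `Representation.IsSmooth`, `IsSmoothVector`, `stabilizerSubgroup`, `isSmoothVector_of_le`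
import HarnessLib

/-!
# Extensions along a length-one presentation, SMOOTH form: if every SMOOTH extension of `V` by `W` splits and `C₀`, `W` are smooth, every `G`-map `C₁ → W` extends to `C₀`,
# and `dim Hom_G(C₀, W) = dim Hom_G(V, W) + dim Hom_G(C₁, W)`

Generic representation theory of a topological group `G` over a commutative ring `k` (a field for the count); Mathlib `Representation` ∕ `IntertwiningMap` ∕ `prod` ∕ `quotient`,
the tree's ★ `Representation.IsSmooth` (open stabilisers) and ★ (J) `IntertwiningMapPresentationExtension` (row 50).  THEOREMS ONLY (no `def`, no instance, no notation, no named
fact, no `sorry`).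

WHY THIS FILE.  ★ (J)'s `finrank_intertwiningMap_presentation` asks that EVERY extension `0 → W → E → V → 0` of `k[G]`-modules split (`hsplit` over all `Representation k G E`).
The splitting theorems of the consumer (★ 40″ `selfExtension_splits_of_jacquet_selfExtension`, 46″) are statements about SMOOTH extensions only (`hτ : τ.IsSmooth`) — and over
all abstract `k[G]`-modules blanket splitting is false in general (a discontinuous additive character of `G` yields a non-split, non-smooth self-extension of the trivial
representation).  The only extension (J)'s proof ever splits is the PUSHOUT `E_φ = (C₀ × W) ⧸ range (d, −φ)` of ★ (J) §1, which is SMOOTH as soon as `C₀` and `W` are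
(§1 below: products and quotients of smooth representations are smooth).  Hence (J) holds verbatim with `hsplit` restricted to smooth `E`, under `ρ₀.IsSmooth`, `ρW.IsSmooth`.
* §1 `isSmooth_prod`, `isSmooth_quotient`, **`isSmooth_pushout`** (the extension of ★ (J) `exists_pushout_extension` is smooth).
* §2 **`exists_comp_eq_of_forall_smooth_extension_split`** ∕ `comp_surjective_of_forall_smooth_extension_split` — ★ (J) §2 with the smooth `hsplit`.
* §3 **`finrank_intertwiningMap_presentation_of_isSmooth`** — `dim_k Hom_G(C₀, W) = dim_k Hom_G(V, W) + dim_k Hom_G(C₁, W)` (★ (J) §3's injectivity ∕ exactness BY NAME).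
* §4 `finrank_intertwiningMap_self_eq_one_of_forall_exists_eq_smul` — the Schur count `dim_k Hom_G(V, V) = 1` from «every `G`-endomorphism is a scalar» (the consumer feeds ★
  `Representation.IsAdmissible.exists_eq_smul_id`), and the combined count `dim Hom_G(C₀, V) = 1 + dim Hom_G(C₁, V)` («`EP(V, V) = 1`»).
Consumer (cell `pub/hodgecm-mathlib`, crux H413 = `stmt-HodgeConjecture-24833`, E1 rows 58∕59): the Euler–Poincaré norm `⟨χ_σ, χ_σ⟩_e = Σ_q (−1)^q dim Hom_G(C_q(X;σ), σ) = 1` over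
the Schneider–Stuhler presentation `0 → C₁(X;σ) → C₀(X;σ) → σ → 0` (★ `shortExact_univ`), with `Ext¹`-vanishing supplied as «smooth self-extensions split».
HONEST LABEL: count-neutral generic helper; HC_CM is proved only modulo the printed citations until rung 0 closes.

## References
* [Weibel1994] C. A. Weibel, *An Introduction to Homological Algebra* (1994), §3.4 Thm. 3.4.3 (extensions and the connecting map; pushout of a presentation).
* [Fuchs1970] L. Fuchs, *Infinite Abelian Groups I* (1970), §10 Theorem 10.2 and (b) (PDF pp. 52–53) (the pushout `(A ⊕ B) ∕ {(αc, −βc)}`).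
* [BernsteinZelevinsky1976] I. N. Bernstein, A. V. Zelevinsky, *Representations of the group GL(n, F) where F is a non-archimedean local field*, Russian Math. Surveys 31
  (1976), §2.1 (smooth representations: subrepresentations, quotients and finite products of smooth representations are smooth), Prop. 2.11 (Schur's lemma).
-/

set_option autoImplicit false

namespace Literature.RepresentationTheory

open Representation Function

universe u u' v

/-! ## §1 Products, quotients, and the pushout of smooth representations are smooth -/

section Smooth

variable {k : Type u} [CommRing k] {G : Type u'} [Group G] [TopologicalSpace G] [SeparatelyContinuousMul G]
  {M₀ Y : Type v} [AddCommGroup M₀] [Module k M₀] [AddCommGroup Y] [Module k Y]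
  (ρ₀ : Representation k G M₀) (ρW : Representation k G Y)

/-- **A finite product of smooth representations is smooth**: the stabiliser of `(c, w)` contains the open subgroup `Stab(c) ∩ Stab(w)`.
[cite: BernsteinZelevinsky1976, §2.1] -/
theorem isSmooth_prod (h₀ : ρ₀.IsSmooth) (hW : ρW.IsSmooth) : (ρ₀.prod ρW).IsSmooth := fun y =>
  (ρ₀.prod ρW).isSmoothVector_of_le (K := ρ₀.stabilizerSubgroup y.1 ⊓ ρW.stabilizerSubgroup y.2) ((h₀ y.1).inter (hW y.2)) fun g hg => by
    rw [mem_stabilizerSubgroup, prod_apply_apply]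
    exact Prod.ext ((ρ₀.mem_stabilizerSubgroup y.1 g).1 hg.1) ((ρW.mem_stabilizerSubgroup y.2 g).1 hg.2)

/-- **A quotient of a smooth representation is smooth**: the stabiliser of `[x]` contains the (open) stabiliser of `x`. [cite: BernsteinZelevinsky1976, §2.1] -/
theorem isSmooth_quotient {M : Type v} [AddCommGroup M] [Module k M] (ρ : Representation k G M) (hρ : ρ.IsSmooth)
    (H : Submodule k M) (hH : ∀ g, H ≤ H.comap (ρ g)) : (ρ.quotient H hH).IsSmooth := fun x => by
  obtain ⟨m, rfl⟩ := Submodule.Quotient.mk_surjective H x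
  refine (ρ.quotient H hH).isSmoothVector_of_le (hρ m) fun g hg => ?_
  rw [mem_stabilizerSubgroup, Representation.quotient_apply, Submodule.mapQ_apply]
  change Submodule.Quotient.mk (ρ g m) = Submodule.Quotient.mk m
  rw [(ρ.mem_stabilizerSubgroup m g).1 hg]

/-- **THE PUSHOUT EXTENSION OF ★ (J) IS SMOOTH** when `C₀` and `W` are: `E_φ = (C₀ × W) ⧸ range (d, −φ)` is a quotient of the smooth product `C₀ × W`.
[cite: BernsteinZelevinsky1976, §2.1] [cite: Fuchs1970, §10 Theorem 10.2 (PDF pp. 52–53)] -/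
theorem isSmooth_pushout (h₀ : ρ₀.IsSmooth) (hW : ρW.IsSmooth) (H : Submodule k (M₀ × Y)) (hH : ∀ g, H ≤ H.comap ((ρ₀.prod ρW) g)) :
    ((ρ₀.prod ρW).quotient H hH).IsSmooth :=
  isSmooth_quotient _ (isSmooth_prod ρ₀ ρW h₀ hW) H hH

end Smooth

/-! ## §2 The sentence with the SMOOTH splitting hypothesis -/

section Sentence

variable {k : Type u} [CommRing k] {G : Type u'} [Group G] [TopologicalSpace G] [SeparatelyContinuousMul G]
  {M₁ M₀ X Y : Type v} [AddCommGroup M₁] [Module k M₁] [AddCommGroup M₀] [Module k M₀]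
  [AddCommGroup X] [Module k X] [AddCommGroup Y] [Module k Y]
  (ρ₁ : Representation k G M₁) (ρ₀ : Representation k G M₀) (ρV : Representation k G X) (ρW : Representation k G Y)
  (d : IntertwiningMap ρ₁ ρ₀) (ε : IntertwiningMap ρ₀ ρV)

/-- **IF EVERY SMOOTH EXTENSION OF `V` BY `W` SPLITS AND `C₀`, `W` ARE SMOOTH, EVERY `G`-MAP `C₁ → W` EXTENDS ALONG `d` TO `C₀`.**  ★ (J) `exists_comp_eq_of_forall_extension_split`
with `hsplit` asked only of SMOOTH `E`: the one extension the proof splits is the pushout `E_φ` of ★ (J) §1, smooth by §1; then, verbatim as in (J), a section `s` of its `p` gives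
`ψ := i⁻¹ ∘ (c ↦ [(c, 0)] − s (ε c))` with `ψ ∘ d = φ`. [cite: Weibel1994, §3.4 Thm. 3.4.3] [cite: Fuchs1970, §10 Theorem 10.2 (PDF pp. 52–53)] -/
theorem exists_comp_eq_of_forall_smooth_extension_split (h₀ : ρ₀.IsSmooth) (hW : ρW.IsSmooth)
    (hd : Injective d) (hexact : LinearMap.ker ε.toLinearMap = LinearMap.range d.toLinearMap) (hε : Surjective ε)
    (hsplit : ∀ (E : Type v) [AddCommGroup E] [Module k E] (ρE : Representation k G E), ρE.IsSmooth → ∀ (i : IntertwiningMap ρW ρE) (p : IntertwiningMap ρE ρV),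
      Injective i → LinearMap.ker p.toLinearMap = LinearMap.range i.toLinearMap → Surjective p → ∃ s : IntertwiningMap ρV ρE, p.comp s = IntertwiningMap.id ρV)
    (φ : IntertwiningMap ρ₁ ρW) : ∃ ψ : IntertwiningMap ρ₀ ρW, ψ.comp d = φ := by
  obtain ⟨i, p, hi, hker, hp, hi_apply, hp_apply⟩ := exists_pushout_extension ρ₁ ρ₀ ρV ρW d ε hd hexact hε φ
  obtain ⟨s, hs⟩ := hsplit _ _ (isSmooth_pushout ρ₀ ρW h₀ hW _ (prod_range_le_comap ρ₁ ρ₀ ρW d φ)) i p hi hker hp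
  have hps : ∀ x : X, p (s x) = x := fun x => by
    have := congrArg (fun f : IntertwiningMap ρV ρV => f x) hs
    simpa using this
  -- `L c := [(c, 0)] − s (ε c)` lies in `ker p = range i`
  let L : M₀ →ₗ[k] (M₀ × Y) ⧸ LinearMap.range (d.toLinearMap.prod (-φ.toLinearMap)) :=
    (LinearMap.range (d.toLinearMap.prod (-φ.toLinearMap))).mkQ ∘ₗ LinearMap.inl k M₀ Y - s.toLinearMap ∘ₗ ε.toLinearMap
  have hLv : ∀ c : M₀, L c = Submodule.Quotient.mk (c, 0) - s (ε c) := fun c => rfl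
  have hL : ∀ c : M₀, L c ∈ LinearMap.range i.toLinearMap := fun c => by
    rw [← hker, LinearMap.mem_ker, IntertwiningMap.toLinearMap_apply, hLv, map_sub, hp_apply, hps, sub_self]
  -- `L` intertwines `ρ₀` with `ρE`
  have hLg : ∀ (g : G) (c : M₀), L (ρ₀ g c) =
      (ρ₀.prod ρW).quotient (LinearMap.range (d.toLinearMap.prod (-φ.toLinearMap))) (prod_range_le_comap ρ₁ ρ₀ ρW d φ) g (L c) := fun g c => by
    rw [hLv, hLv, map_sub, IntertwiningMap.isIntertwining _ _ ε g c, IntertwiningMap.isIntertwining _ _ s g (ε c),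
      Representation.quotient_apply, Submodule.mapQ_apply]
    change Submodule.Quotient.mk (ρ₀ g c, 0) - _ = Submodule.Quotient.mk (ρ₀ g c, ρW g 0) - _
    rw [map_zero]
  -- `ψ := i⁻¹ ∘ L`
  have hi' : Injective i.toLinearMap := fun a b h => hi h
  let e := LinearEquiv.ofInjective i.toLinearMap hi'
  let ψl : M₀ →ₗ[k] Y := e.symm.toLinearMap ∘ₗ L.codRestrict (LinearMap.range i.toLinearMap) hL
  have hiψ : ∀ c : M₀, i (ψl c) = L c := fun c => by
    have h := congrArg Subtype.val (e.apply_symm_apply ⟨L c, hL c⟩)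
    exact h
  have hψg : ∀ (g : G) (c : M₀), ψl (ρ₀ g c) = ρW g (ψl c) := fun g c =>
    hi (by rw [hiψ, hLg, ← hiψ, IntertwiningMap.isIntertwining _ _ i g (ψl c)])
  refine ⟨ψl.intertwiningMap_of_isIntertwiningMap _ _ hψg, IntertwiningMap.ext (LinearMap.ext fun c₁ => hi ?_)⟩
  change i (ψl (d c₁)) = i (φ c₁)
  rw [hiψ, hLv, hi_apply]
  have h0 : ε (d c₁) = 0 := by
    have : d c₁ ∈ LinearMap.ker ε.toLinearMap := by rw [hexact]; exact ⟨c₁, rfl⟩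
    exact this
  rw [h0, map_zero, sub_zero, Submodule.Quotient.eq]
  exact ⟨c₁, Prod.ext (by change d c₁ = d c₁ - 0; rw [sub_zero]) (by change -(φ c₁) = 0 - φ c₁; rw [zero_sub])⟩

/-- **MAP FORM: THE RESTRICTION `Hom_G(C₀, W) → Hom_G(C₁, W)`, `ψ ↦ ψ ∘ d`, IS SURJECTIVE** when `C₀`, `W` are smooth and every smooth extension of `V` by `W` splits.
[cite: Weibel1994, §3.4 Thm. 3.4.3] -/
theorem comp_surjective_of_forall_smooth_extension_split (h₀ : ρ₀.IsSmooth) (hW : ρW.IsSmooth)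
    (hd : Injective d) (hexact : LinearMap.ker ε.toLinearMap = LinearMap.range d.toLinearMap) (hε : Surjective ε)
    (hsplit : ∀ (E : Type v) [AddCommGroup E] [Module k E] (ρE : Representation k G E), ρE.IsSmooth → ∀ (i : IntertwiningMap ρW ρE) (p : IntertwiningMap ρE ρV),
      Injective i → LinearMap.ker p.toLinearMap = LinearMap.range i.toLinearMap → Surjective p → ∃ s : IntertwiningMap ρV ρE, p.comp s = IntertwiningMap.id ρV) :
    Surjective (fun ψ : IntertwiningMap ρ₀ ρW => ψ.comp d) := fun φ =>
  exists_comp_eq_of_forall_smooth_extension_split ρ₁ ρ₀ ρV ρW d ε h₀ hW hd hexact hε hsplit φ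

end Sentence

/-! ## §3 The dimension count with the SMOOTH splitting hypothesis -/

section Count

variable {k : Type u} [Field k] {G : Type u'} [Group G] [TopologicalSpace G] [SeparatelyContinuousMul G]
  {M₁ M₀ X Y : Type v} [AddCommGroup M₁] [Module k M₁] [AddCommGroup M₀] [Module k M₀]
  [AddCommGroup X] [Module k X] [AddCommGroup Y] [Module k Y]
  (ρ₁ : Representation k G M₁) (ρ₀ : Representation k G M₀) (ρV : Representation k G X) (ρW : Representation k G Y)
  (d : IntertwiningMap ρ₁ ρ₀) (ε : IntertwiningMap ρ₀ ρV)

/-- **`dim_k Hom_G(C₀, W) = dim_k Hom_G(V, W) + dim_k Hom_G(C₁, W)`** for a length-one presentation `0 → C₁ → C₀ → V → 0` with `C₀` SMOOTH and a SMOOTH target `W` all of whose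
SMOOTH extensions by `V` split, `Hom_G(C₀, W)` finite-dimensional: rank–nullity for `ψ ↦ ψ ∘ d` (surjective, §2; kernel `≅ Hom_G(V, W)` by ★ (J) `comp_injective_of_surjective`,
`comp_eq_zero_iff_exists_comp_eq`).  «`Σ_q (−1)^q dim Hom_G(C_q, W) = dim Hom_G(V, W)` when smooth `Ext¹_G(V, W) = 0`», without `Ext`.
[cite: Weibel1994, §3.4 Thm. 3.4.3] [cite: BernsteinZelevinsky1976, §2.1] -/
theorem finrank_intertwiningMap_presentation_of_isSmooth (h₀ : ρ₀.IsSmooth) (hW : ρW.IsSmooth)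
    (hd : Injective d) (hexact : LinearMap.ker ε.toLinearMap = LinearMap.range d.toLinearMap) (hε : Surjective ε)
    (hsplit : ∀ (E : Type v) [AddCommGroup E] [Module k E] (ρE : Representation k G E), ρE.IsSmooth → ∀ (i : IntertwiningMap ρW ρE) (p : IntertwiningMap ρE ρV),
      Injective i → LinearMap.ker p.toLinearMap = LinearMap.range i.toLinearMap → Surjective p → ∃ s : IntertwiningMap ρV ρE, p.comp s = IntertwiningMap.id ρV)
    [FiniteDimensional k (IntertwiningMap ρ₀ ρW)] :
    Module.finrank k (IntertwiningMap ρ₀ ρW) = Module.finrank k (IntertwiningMap ρV ρW) + Module.finrank k (IntertwiningMap ρ₁ ρW) := by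
  -- the restriction `res : ψ ↦ ψ ∘ d` and the inflation `inf : χ ↦ χ ∘ ε`, `k`-linear
  let res : IntertwiningMap ρ₀ ρW →ₗ[k] IntertwiningMap ρ₁ ρW := (IntertwiningMap.llcomp ρ₁ ρ₀ ρW).flip d
  have hres : ∀ ψ, res ψ = ψ.comp d := fun ψ => rfl
  let inf : IntertwiningMap ρV ρW →ₗ[k] IntertwiningMap ρ₀ ρW := (IntertwiningMap.llcomp ρ₀ ρV ρW).flip ε
  have hinf : ∀ χ, inf χ = χ.comp ε := fun χ => rfl
  -- `res` surjective (§2), `inf` injective, `range inf = ker res` (★ (J) §3)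
  have hsurj : LinearMap.range res = ⊤ :=
    LinearMap.range_eq_top.2 (comp_surjective_of_forall_smooth_extension_split ρ₁ ρ₀ ρV ρW d ε h₀ hW hd hexact hε hsplit)
  have hinj : Injective inf := comp_injective_of_surjective ρ₀ ρV ρW ε hε
  have hrk : LinearMap.range inf = LinearMap.ker res := by
    ext ψ
    rw [LinearMap.mem_range, LinearMap.mem_ker, hres, comp_eq_zero_iff_exists_comp_eq ρ₁ ρ₀ ρV ρW d ε hexact hε ψ]
    exact ⟨fun ⟨y, hy⟩ => ⟨y, hy⟩, fun ⟨y, hy⟩ => ⟨y, hy⟩⟩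
  -- rank–nullity
  have h := LinearMap.finrank_range_add_finrank_ker res
  rw [hsurj, finrank_top, ← hrk, LinearMap.finrank_range_of_inj hinj] at h
  omega

end Count

/-! ## §4 The Schur count and «`EP(V, V) = 1`» -/

section Schur

variable {k : Type u} [Field k] {G : Type u'} [Group G]
  {X : Type v} [AddCommGroup X] [Module k X] (ρV : Representation k G X)

/-- **`dim_k Hom_G(V, V) = 1` when every `G`-endomorphism of `V ≠ 0` is a scalar** (Schur): `c ↦ c • id` is then a linear isomorphism `k ≃ Hom_G(V, V)` (injective because
`V ≠ 0`).  The consumer feeds ★ `Representation.IsAdmissible.exists_eq_smul_id` (admissible irreducible smooth `V` over `ℂ`). [cite: BernsteinZelevinsky1976, Prop. 2.11] -/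
theorem finrank_intertwiningMap_self_eq_one_of_forall_exists_eq_smul [Nontrivial X]
    (hschur : ∀ T : IntertwiningMap ρV ρV, ∃ c : k, T.toLinearMap = c • LinearMap.id) :
    Module.finrank k (IntertwiningMap ρV ρV) = 1 := by
  -- `c ↦ c • id`
  let u : k →ₗ[k] IntertwiningMap ρV ρV := LinearMap.toSpanSingleton k (IntertwiningMap ρV ρV) (IntertwiningMap.id ρV)
  have hu : ∀ c : k, (u c).toLinearMap = c • LinearMap.id := fun c => by
    change (c • IntertwiningMap.id ρV).toLinearMap = c • LinearMap.id
    rfl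
  have hinj : Injective u := fun a b h => by
    obtain ⟨x, hx⟩ := exists_ne (0 : X)
    have h' := congrArg (fun T : IntertwiningMap ρV ρV => T.toLinearMap x) h
    simp only [hu, LinearMap.smul_apply, LinearMap.id_apply] at h'
    exact smul_left_injective k hx h'
  have hsurj : Surjective u := fun T => by
    obtain ⟨c, hc⟩ := hschur T
    exact ⟨c, IntertwiningMap.ext (by rw [hu, hc])⟩
  rw [← (LinearEquiv.ofBijective u ⟨hinj, hsurj⟩).finrank_eq, Module.finrank_self]

end Schur

section EPOne

variable {k : Type u} [Field k] {G : Type u'} [Group G] [TopologicalSpace G] [SeparatelyContinuousMul G]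
  {M₁ M₀ X : Type v} [AddCommGroup M₁] [Module k M₁] [AddCommGroup M₀] [Module k M₀] [AddCommGroup X] [Module k X]
  (ρ₁ : Representation k G M₁) (ρ₀ : Representation k G M₀) (ρV : Representation k G X)
  (d : IntertwiningMap ρ₁ ρ₀) (ε : IntertwiningMap ρ₀ ρV)

/-- **«`EP(V, V) = 1`»: `dim_k Hom_G(C₀, V) = 1 + dim_k Hom_G(C₁, V)`** for a length-one presentation `0 → C₁ → C₀ → V → 0` of a smooth `V ≠ 0` with `C₀` smooth, every SMOOTH
self-extension of `V` split, every `G`-endomorphism of `V` a scalar, and `Hom_G(C₀, V)` finite-dimensional (§3 at `W = V` + §4).  This is the count behind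
«`⟨χ_σ, χ_σ⟩_e = Σ_q (−1)^q dim Hom_G(C_q(X;σ), σ) = 1`». [cite: Weibel1994, §3.4 Thm. 3.4.3] [cite: BernsteinZelevinsky1976, §2.1, Prop. 2.11] -/
theorem finrank_intertwiningMap_presentation_self_of_isSmooth [Nontrivial X] (h₀ : ρ₀.IsSmooth) (hV : ρV.IsSmooth)
    (hd : Injective d) (hexact : LinearMap.ker ε.toLinearMap = LinearMap.range d.toLinearMap) (hε : Surjective ε)
    (hsplit : ∀ (E : Type v) [AddCommGroup E] [Module k E] (ρE : Representation k G E), ρE.IsSmooth → ∀ (i : IntertwiningMap ρV ρE) (p : IntertwiningMap ρE ρV),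
      Injective i → LinearMap.ker p.toLinearMap = LinearMap.range i.toLinearMap → Surjective p → ∃ s : IntertwiningMap ρV ρE, p.comp s = IntertwiningMap.id ρV)
    (hschur : ∀ T : IntertwiningMap ρV ρV, ∃ c : k, T.toLinearMap = c • LinearMap.id)
    [FiniteDimensional k (IntertwiningMap ρ₀ ρV)] :
    Module.finrank k (IntertwiningMap ρ₀ ρV) = 1 + Module.finrank k (IntertwiningMap ρ₁ ρV) := by
  rw [finrank_intertwiningMap_presentation_of_isSmooth ρ₁ ρ₀ ρV ρV d ε h₀ hV hd hexact hε hsplit,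
    finrank_intertwiningMap_self_eq_one_of_forall_exists_eq_smul ρV hschur]

end EPOne

end Literature.RepresentationTheory
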